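import Literature.MathematicalPhysics.QuantumFieldTheory.Balaban1983to89.B8Prop6DentedCubeMemberGammaRec
import Literature.MathematicalPhysics.QuantumFieldTheory.Balaban1983to89.B8Thm4Windows
import Literature.MathematicalPhysics.QuantumFieldTheory.Balaban1983to89.B8CubeMemberZdRec
import Literature.MathematicalPhysics.QuantumFieldTheory.Balaban1983to89.B8Prop6DentedCubeMemberNormsGamma

/-!
# `Balaban1983to89.B8Prop6DentedCubeMemberNormsGammaRec` — RECORD TWIN of `B8Prop6DentedCubeMemberNormsGamma` §1 ([Balaban1985RegularSpaces] (1.42)₂ at all levels on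
# print's split class at the DENTED member, background `1`, edition γ), with the RECORD's Proposition-3 windows from one threshold and the centred margin ∕ level-0 cell
# bookkeeping the crown's norm step reads — FOR THE SYMMETRISED CENTRED block averaging (0.4) of [Balaban1987RG1]

statement-level skeleton of published theorems with citation tags; proofs where landed; nothing here is a claim about the Yang–Mills mass gap

T. Bałaban, *Spaces of regular gauge field configurations on a lattice and gauge fixing conditions*, Commun. Math. Phys. **99** (1985) 75–102 `[Balaban1985RegularSpaces]`
("[6]"): (1.42) p. 83, (1.37) p. 82, (1.31) p. 82, Prop. 3 p. 87, (1.131)–(1.133) p. 99, p. 98; T. Bałaban, *Averaging operations for lattice gauge theories*, Commun. Math.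
Phys. **98** (1985) 17–51 `[Balaban1985Averaging]` ("[3]"): Prop. 4 p. 38, (127) p. 37; T. Bałaban, *The variational problem and background fields in renormalization group
method for lattice gauge theories*, Commun. Math. Phys. **102** (1985) 277–309 `[Balaban1985Variational]` ("[15]"): (148)–(152) p. 301; T. Bałaban, *Renormalization group
approach to lattice gauge field theories. I*, Commun. Math. Phys. **109** (1987) 249–301 `[Balaban1987RG1]` ("[I]"): (0.3)–(0.4) pp. 252–253.  STATUS: published.

CITATION HEADER (lean-in-tree rule).  Cell `pub-ymgap`, «N05-REC» stage 2 (director-ym №254∕№255∕№288), item R6 (the crown road), module (g)-2 of the lead pen's `R6-PLAN.md`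
— typed by the LEAD PEN dag-n05-e g38 on dag-n05-c's recipe (inventory `N05-REC-INVENTORY.md` §R6 row `B8Prop6DentedCubeMemberNormsGamma`: class A = `c137_dentedMember_γ`;
the engine's §2 `norms136_dentedMember_at_γ_d4` is not on the crown's kernel cone and is not twinned).  WHAT IS REPRODUCED = ✓§1 `c137_dentedMember_γ` over the record
`B8Eq142KLevelLocalGammaRec.H42_of_inAx_γ` at the dented record datum (`thm4_hypotheses_one_cutFixed_dented_γ`, `mlogCfg_spec`, the class laws `lamBPT_hbox_pred ∕ lamBPT_hclass` of
`B8DentedCubeMemberZdRec`); NEW bookkeeping for the record's regime: §0 `prop3_windowsZ` (the record's eight Prop.-3 windows + the (1.56)-constant bound from ONE threshold — twin of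
`B8LeafModelZd3.prop3_windows` with `C0Z`, `e^{4cZ·α₀}(1 + 2C₁KZ²·α₂) ≤ 2`, `KZ·α₂ ≤ c₃`, `(1+2gZ)·2C₁KZ²·e^{4cZ·α₀} ≤ 2(1+2gZ)·2C₁KZ²`), §2 `margin2_cubeFamZ` (twin of
`B9SupplySockB9P3ZdLettersOmega.margin2_cubeFam`, centred boxes — the engine's margin arithmetic verbatim), `cubeLamZ_subset_lamS`, `mem_lamS_zero_of_not_mem_cube_one` (the level-`0`
cell of a fine site of `□₀ ∖ □₁`).  TOKEN MAP: `logCovIter ∕ cutFixed ∕ Restr129 ∕ InAx ↦ …Z`; `(hL : 2 ≤ L) ↦ (hLs : L = 2s+1) (hs : 1 ≤ s)`; the engine's h16′ is not needed by the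
record `H42_of_inAx_γ`.  Declaration names = engine names (T5).  Kind «kernel-checked proof», theorems only; no `def`, no `instance`, no `notation`, no existing module modified.
`--supports stmt-QuantumFields-20541` (K0⁷-keyed, COUNT-NEUTRAL).

HONEST SCOPE: by-name composition + threshold arithmetic + integer box bookkeeping; nothing of Bałaban's analysis re-proved; `HThm4Rec` UNDISCHARGED; caveat (C-S3-1) + addendum
v4 stand; N05 [B8] DISCHARGED OF RECORD untouched; N05 ∕ N07 NOT discharged; COUNT of record unmoved · K numerically unchanged; one finite `𝕋⁴` programme at fixed `ε`, Bałaban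
AS PRINTED; nothing continuum ∕ ℝ⁴ ∕ OS ∕ mass-gap ∕ Clay.  No `sorry`, no `def`.

[cite: Balaban1985RegularSpaces, (1.42) p.83, (1.37) p.82, Prop. 3 p.87, (1.131)–(1.133) p.99, p.98; Balaban1985Averaging, Prop. 4 p.38; Balaban1985Variational, (148)–(152) p.301; Balaban1987RG1, (0.3)–(0.4) pp.252–253]
-/

noncomputable section

open NormedSpace

namespace Literature.MathematicalPhysics.QuantumFieldTheory.Balaban1983to89.B8Prop6DentedCubeMemberNormsGammaRec

open MatrixLog B7Prop1Explicit B7Prop2Explicit B7Prop1Local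
open B7Eq92Concrete (mgauge mgauge_one_left)
open B7Prop2Explicit (c2' c2'_pos unitaryUnits)
open B7Prop2Rec (AvgClosedZ C0Z C0Z_pos)
open B7Prop3Flat (c3 c3_pos)
open B7Prop4GeneralLevelsRec (cZ gZ KZ gZ_nonneg)
open BlockAveragingZd (avgIterZ ctrShift)
open B7SectEFLinearisationRec (logCovIterZ)
open B8Ineq130Rec (tlo thi)
open B8Ineq130 (gaugeAct_one)
open B8Ineq132 (InAk)
open B8Ineq133Rec (cutFixedZ)
open B8Eq115GaugeFixing (gaugeAct_mul gaugeAct_mem_of)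
open B8Eq119TwistedAxialRec (InAxZ Restr129Z)
open B8Eq146AExpansion (iEta)
open B8Eq184Proof (cfgExp)
open B8Eq140Level (SideTouches)
open B8Eq138LandauZd (logCfg)
open B8Eq131Cubes (tLo tHi ctr gs margin_succ margin_anti)
open B8Eq131CubesRec (bLoZ bHiZ sqLoZ sqHiZ inLoZ inHiZ cubeZ cube_eq inner_eq_blowup)
open B8Eq131CubesAdmissibleRec (cubeFamZ cubeFam_false_of_le cubeFam_false_zero cubeFam_of_lt)
open B8CubeMemberZdRec (cubeLamZ)
open B8LeafModelZd3 (mlogCfg mlogCfg_spec)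
open B8Thm4Windows (mul_le_one_of_le_inv exp_le_of_small)
open B9SupplySockB9P3ZdLettersOmega (Margin2)
open B8Eq142KLevelLocalGammaRec (H42_of_inAx_γ)
open B8Prop6DentedCubeMemberGammaRec (thm4_hypotheses_one_cutFixed_dented_γ)
open B8DentedCubeMemberZdRec (lamST_top_apply hΩ_sq lamBPT_hbox_pred lamBPT_hclass)
open Node00 (CubeB8DZ)

-- `Site` alone could resolve to the torus sites of `Setup.lean`; re-export the `ℤ^d` sites of `B7Prop1Explicit`.
export B7Prop1Explicit (Site)

variable {d : ℕ}

/-! ## §0 Proposition 3's RECORD windows from ONE threshold -/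

section Windows

/-- (RECORD TWIN of `B8LeafModelZd3.prop3_windows`.) **Proposition 3's windows in the RECORD regime from ONE threshold** `c(d, L, B₀) = 1∕M`, `M` the sum of the windows'
coefficients: for `0 < α₀ ≤ c`, `0 ≤ α₂ ≤ c` — `C0Z·α₀ ≤ 1∕3`, `4α₀ ≤ c₂′`, `16α₂ ≤ 1`, `5α₂(d − 1) ≤ 4`, the record Prop-4 window `e^{4cZ·α₀}(1 + 2C₁KZ²·α₂) ≤ 2`,
`KZ·α₂ ≤ c₃`, `36dB₀α₂ ≤ 1∕2`, `50dα₂ ≤ 1`, and the (1.56)-constant `(1+2gZ)·2C₁KZ²·e^{4cZ·α₀} ≤ 2(1+2gZ)·2C₁KZ²` (`C₁ = 131072(d+1)²`).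
[cite: Balaban1985RegularSpaces, Prop. 3 p.87 («α₀, α₁, α₂ bounded by a constant depending on d and L only»); Balaban1985Averaging, Prop. 4 p.38; Balaban1987RG1, (0.4) p.253] -/
theorem prop3_windowsZ (hd : 1 ≤ d) {L : ℕ} (hL : 1 ≤ L) {B₀ : ℝ} (hB₀ : 0 ≤ B₀) :
    ∃ c : ℝ, 0 < c ∧ ∀ α₀ α₂ : ℝ, 0 < α₀ → α₀ ≤ c → 0 ≤ α₂ → α₂ ≤ c →
      C0Z d * α₀ ≤ 1 / 3 ∧ 4 * α₀ ≤ c2' d L ∧ 16 * α₂ ≤ 1 ∧ 5 * α₂ * ((d : ℝ) - 1) ≤ 4 ∧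
      Real.exp (4 * cZ d * α₀) * (1 + 2 * (131072 * ((d : ℝ) + 1) ^ 2) * (KZ d L) ^ 2 * α₂) ≤ 2 ∧
      KZ d L * α₂ ≤ c3 d L ∧ 36 * d * B₀ * α₂ ≤ 1 / 2 ∧ 50 * d * α₂ ≤ 1 ∧
      (1 + 2 * gZ d L) * (2 * (131072 * ((d : ℝ) + 1) ^ 2) * (KZ d L) ^ 2) * Real.exp (4 * cZ d * α₀)
        ≤ 2 * ((1 + 2 * gZ d L) * (2 * (131072 * ((d : ℝ) + 1) ^ 2) * (KZ d L) ^ 2)) := by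
  have hd' : (1 : ℝ) ≤ d := by exact_mod_cast hd
  have hd0 : (0 : ℝ) < d := by linarith
  have hc2 : 0 < c2' d L := c2'_pos d L hL
  have hc3 : 0 < c3 d L := c3_pos d hL
  have hC0 : 0 < C0Z d := C0Z_pos d
  have hg0 : 0 ≤ gZ d L := gZ_nonneg d L
  obtain ⟨E, hE⟩ : ∃ E : ℝ, E = 4 * cZ d := ⟨_, rfl⟩
  obtain ⟨F, hF⟩ : ∃ F : ℝ, F = 2 * (131072 * ((d : ℝ) + 1) ^ 2) * (KZ d L) ^ 2 := ⟨_, rfl⟩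
  obtain ⟨G, hG⟩ : ∃ G : ℝ, G = (1 + 2 * gZ d L) * F := ⟨_, rfl⟩
  have hE0 : 0 < E := by rw [hE]; unfold cZ; positivity
  have hF0 : 0 ≤ F := by rw [hF]; positivity
  have hG0 : 0 ≤ G := by rw [hG]; positivity
  have hKZ0 : 0 ≤ KZ d L := by unfold KZ; positivity
  obtain ⟨M, hM⟩ : ∃ M : ℝ, M = 3 * C0Z d + 4 / c2' d L + 16 * E + 2 * F + KZ d L / c3 d L + 80 * d + 72 * d * (B₀ + 1) := ⟨_, rfl⟩
  have hM0 : 0 < M := by rw [hM]; positivity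
  refine ⟨1 / M, by positivity, fun α₀ α₂ hα₀ hα₀c hα₂ hα₂c => ?_⟩
  have hw₀ : ∀ {D : ℝ}, D ≤ M → D * α₀ ≤ 1 := fun hDM => mul_le_one_of_le_inv hDM hM0 hα₀.le hα₀c
  have hw₂ : ∀ {D : ℝ}, D ≤ M → D * α₂ ≤ 1 := fun hDM => mul_le_one_of_le_inv hDM hM0 hα₂ hα₂c
  have hposB : 0 ≤ 72 * (d : ℝ) * (B₀ + 1) := by positivity
  have hpos2 : 0 ≤ KZ d L / c3 d L := by positivity
  have hpos3 : 0 ≤ 4 / c2' d L := by positivity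
  have h5 : 3 * C0Z d * α₀ ≤ 1 := hw₀ (by rw [hM]; linarith)
  have h6 : 4 / c2' d L * α₀ ≤ 1 := hw₀ (by rw [hM]; linarith)
  have h9 : 16 * E * α₀ ≤ 1 := hw₀ (by rw [hM]; linarith)
  have h9' : 2 * F * α₂ ≤ 1 := hw₂ (by rw [hM]; linarith)
  have h10 : KZ d L / c3 d L * α₂ ≤ 1 := hw₂ (by rw [hM]; linarith)
  have h80 : 80 * d * α₂ ≤ 1 := hw₂ (by rw [hM]; linarith)
  have h72 : 72 * d * (B₀ + 1) * α₂ ≤ 1 := hw₂ (by rw [hM]; linarith)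
  -- the exponential factor
  have hx0 : 0 ≤ E * α₀ := by positivity
  have hx1 : E * α₀ ≤ 1 / 16 := by
    have e : 16 * (E * α₀) = 16 * E * α₀ := by ring
    linarith [h9, e]
  have hexp : Real.exp (E * α₀) ≤ 9 / 8 := exp_le_of_small hx0 hx1
  have hE' : 4 * cZ d * α₀ = E * α₀ := by rw [hE]
  rw [hE', ← hF, ← hG]
  have hdα : (d : ℝ) * α₂ ≤ 1 / 80 := by
    have e : 80 * ((d : ℝ) * α₂) = 80 * d * α₂ := by ring
    linarith [h80, e]
  have hα80 : α₂ ≤ 1 / 80 := by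
    have e : α₂ ≤ (d : ℝ) * α₂ := le_mul_of_one_le_left hα₂ hd'
    linarith [hdα, e]
  refine ⟨?_, ?_, ?_, ?_, ?_, ?_, ?_, ?_, ?_⟩
  · linarith [h5]
  · have h3 : 4 / c2' d L * α₀ * c2' d L ≤ 1 * c2' d L := mul_le_mul_of_nonneg_right h6 hc2.le
    have h4 : 4 / c2' d L * α₀ * c2' d L = 4 * α₀ := by field_simp
    linarith
  · linarith [hα80]
  · have e : 5 * α₂ * ((d : ℝ) - 1) = 5 * ((d : ℝ) * α₂) - 5 * α₂ := by ring
    linarith [hdα, hα₂, e]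
  · have hy : F * α₂ ≤ 1 / 2 := by linarith [h9']
    have hy0 : 0 ≤ F * α₂ := by positivity
    calc Real.exp (E * α₀) * (1 + F * α₂) ≤ (9 / 8) * (1 + 1 / 2) := mul_le_mul hexp (by linarith) (by positivity) (by norm_num)
      _ ≤ 2 := by norm_num
  · have h3 : KZ d L / c3 d L * α₂ * c3 d L ≤ 1 * c3 d L := mul_le_mul_of_nonneg_right h10 hc3.le
    have h4 : KZ d L / c3 d L * α₂ * c3 d L = KZ d L * α₂ := by field_simp
    linarith
  · have e : 72 * (d : ℝ) * (B₀ + 1) * α₂ = 72 * d * B₀ * α₂ + 72 * d * α₂ := by ring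
    have h0 : 0 ≤ 72 * (d : ℝ) * α₂ := by positivity
    linarith [e, h0, h72]
  · linarith [h80]
  · have h2 : Real.exp (E * α₀) ≤ 2 := hexp.trans (by norm_num)
    calc G * Real.exp (E * α₀) ≤ G * 2 := by gcongr
      _ = 2 * G := by ring

end Windows

/-! ## §1 (1.42)₂ at all levels on print's split class at the dented RECORD member, background `1` -/

section KLevel

variable {𝔸 : Type*} [CStarAlgebra 𝔸] [Nontrivial 𝔸]

/-- (RECORD TWIN of `B8Prop6DentedCubeMemberNormsGamma.c137_dentedMember_γ`.) ★ **(1.42)₂ AT ALL LEVELS FOR `U₁ = U₀″^{u⁻¹}` AT BACKGROUND `1`, ON EVERY BOND OF THE SPLIT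
PRINT CLASS `c.lamBPT c.k j` OF THE DENTED RECORD MEMBER** — `H42_of_inAx_γ` (record) at the Proposition-6 datum `(1, U₀″)` (unitarity, (1.33), (1.34) = (1.132), `Ax` at every
truncation, and (1.66) = (1.133) in PRINT's guard «box ⊂ Ω′_{j−1}» by `thm4_hypotheses_one_cutFixed_dented_γ`), class laws `lamBPT_hbox_pred` ∕ `lamBPT_hclass` (CENTRED boxes
and blocks), (1.29) w.r.t. the dented record cells `c.lamS`, the exponent `A = mlogCfg` of the (1.62)-data; the record's Prop-4 windows ONE LEVEL LOWER, at `(L²·L³α₀, L·α₂)`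
(odd `L = 2s+1`, `s ≥ 1`).  CONCLUSION: `‖Q_j(1, iηA)(b)‖ < 2dL·(6dL²Mα₀)` for every `j ≤ k`, `b ∈ c.lamBPT c.k j`, record averages.
[cite: Balaban1985RegularSpaces, (1.42) p.83, (1.37) p.82, (1.31) p.82, (1.35) p.82, (1.133) p.99, p.77; Balaban1985Variational, (148)–(152) p.301; Balaban1984PropagatorsII, (2.3) p.224; Balaban1987RG1, (0.3)–(0.4) pp.252–253] -/
theorem c137_dentedMember_γ (hd2 : 2 ≤ d) {L s : ℕ} (hLs : L = 2 * s + 1) (hs : 1 ≤ s) {K : ℕ} {Ω : ℕ → Set (Site d)} (c : CubeB8DZ d L K Ω)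
    (U₀ : Site d → Fin d → 𝔸ˣ) (hU₀ : ∀ x κ, U₀ x κ ∈ unitaryUnits 𝔸) {α₀ : ℝ} (hα : 0 < α₀)
    (hα3 : C0Z d * (α₀ * (L : ℝ) ^ 2) ≤ 1 / 3) (hα2 : 2 * (α₀ * (L : ℝ) ^ 2) ≤ c2' d L)
    {η : ℝ} (hη : 0 < η) (hA : InAk L c.k η α₀ Ω U₀)
    (hsmall : 11 * (d : ℝ) ^ 2 * (L : ℝ) ^ 2 * α₀ + ((c.M : ℝ) + 4 * c.ρ) * d * (L : ℝ) ^ 2 * α₀ ≤ 1 / 6)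
    {α₂ : ℝ} (hα₂ : 0 ≤ α₂) (hα3' : C0Z d * ((L : ℝ) ^ 2 * ((L : ℝ) ^ 3 * α₀)) ≤ 1 / 3) (hα4' : 4 * ((L : ℝ) ^ 2 * ((L : ℝ) ^ 3 * α₀)) ≤ c2' d L)
    (h16 : 16 * α₂ ≤ 1)
    (hsm : Real.exp (4 * cZ d * ((L : ℝ) ^ 2 * ((L : ℝ) ^ 3 * α₀)))
      * (1 + 2 * (131072 * ((d : ℝ) + 1) ^ 2) * (KZ d L) ^ 2 * ((L : ℝ) * α₂)) ≤ 2)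
    (hc₃ : KZ d L * ((L : ℝ) * α₂) ≤ c3 d L) (hsmall₁ : (d : ℝ) * L * (6 * d * (L : ℝ) ^ 2 * c.M * α₀) ≤ 1 / 8)
    (u : Site d → 𝔸ˣ) (hu : ∀ x, u x ∈ unitaryUnits 𝔸)
    (h129 : Restr129Z L c.k (c.lamS) (1 : Site d → Fin d → 𝔸ˣ) u)
    (h162 : ∀ j, j ≤ c.k → ∀ b ∈ {b : Site d × Fin d | SideTouches (c.sq j) b.1 b.2},
      gaugeAct u⁻¹ (cutFixedZ L (tLo c.a c.ρ) (tHi c.a c.M c.ρ) U₀ c.k (ctr c.a c.M)) b.1 b.2 =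
          cfgExp η (logCfg η (gaugeAct u⁻¹ (cutFixedZ L (tLo c.a c.ρ) (tHi c.a c.M c.ρ) U₀ c.k (ctr c.a c.M)))) b.1 b.2 ∧
        IsSelfAdjoint (logCfg η (gaugeAct u⁻¹ (cutFixedZ L (tLo c.a c.ρ) (tHi c.a c.M c.ρ) U₀ c.k (ctr c.a c.M))) b.1 b.2) ∧
        ‖logCfg η (gaugeAct u⁻¹ (cutFixedZ L (tLo c.a c.ρ) (tHi c.a c.M c.ρ) U₀ c.k (ctr c.a c.M))) b.1 b.2‖ ≤ α₂ * ((L : ℝ) ^ j * η)⁻¹) :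
    ∀ j, j ≤ c.k → ∀ b ∈ c.lamBPT c.k j,
      ‖logCovIterZ L (1 : Site d → Fin d → 𝔸ˣ)
          (iEta η (mlogCfg c.k η c.sq (gaugeAct u⁻¹ (cutFixedZ L (tLo c.a c.ρ) (tHi c.a c.M c.ρ) U₀ c.k (ctr c.a c.M)))))
          j b.1 b.2‖ < 2 * d * L * (6 * d * (L : ℝ) ^ 2 * c.M * α₀) := by
  have hL : Odd L := ⟨s, by omega⟩
  have hL1 : 1 ≤ L := by omega
  have hd1 : 1 ≤ d := le_trans (by norm_num) hd2
  have hk : 1 ≤ c.k := c.one_le_k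
  have hρ : 1 ≤ c.ρ := hL1.trans c.L_le_ρ
  have hM1 : 1 ≤ c.M := hρ.trans c.ρ_le_M
  have hLpos : (0 : ℝ) < L := by exact_mod_cast hL1
  have hdpos : (0 : ℝ) < d := by exact_mod_cast hd1
  have hMpos : (0 : ℝ) < c.M := by exact_mod_cast hM1
  have hα₀' : 0 < (L : ℝ) ^ 3 * α₀ := by positivity
  have hα₁' : 0 < 6 * d * (L : ℝ) ^ 2 * c.M * α₀ := by positivity
  set U'' := cutFixedZ L (tLo c.a c.ρ) (tHi c.a c.M c.ρ) U₀ c.k (ctr c.a c.M) with hU''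
  obtain ⟨hmem, h33, h34, hAx, h135, -⟩ :=
    thm4_hypotheses_one_cutFixed_dented_γ hLs hs hd1 c U₀ hU₀ hα hα3 hα2 hη hA hsmall
  have hU₁u : ∀ x κ, gaugeAct u⁻¹ U'' x κ ∈ unitaryUnits 𝔸 :=
    gaugeAct_mem_of hmem fun x => (unitaryUnits 𝔸).inv_mem (hu x)
  -- the canonical exponent: Hermitian, `= (1/iη) log U₁` on the `E j`, `U₁ = e^{iηA}` there, `0` off them
  obtain ⟨hsa, hrep, hzero⟩ := mlogCfg_spec hη hL1 c.k (1 : Site d → Fin d → 𝔸ˣ) hU₁u hα₂ h16 c.sq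
    (fun j hj y τ hs => ⟨(h162 j hj (y, τ) hs).1, (h162 j hj (y, τ) hs).2.2⟩)
  have hWA : ∀ j, j ≤ c.k → ∀ y τ, SideTouches (c.sq j) y τ →
      gaugeAct u⁻¹ U'' y τ = cfgExp η (mlogCfg c.k η c.sq (gaugeAct u⁻¹ U'')) y τ ∧
        ‖mlogCfg c.k η c.sq (gaugeAct u⁻¹ U'') y τ‖ ≤ α₂ * ((L : ℝ) ^ j * η)⁻¹ := fun j hj y τ hs =>
    ⟨(hrep j hj y τ hs).2, by rw [(hrep j hj y τ hs).1]; exact (h162 j hj (y, τ) hs).2.2⟩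
  -- `U₁^{u} = U₀″`
  have hgU : mgauge (1 : Site d → Fin d → 𝔸ˣ) u (gaugeAct u⁻¹ U'') = U'' := by
    rw [mgauge_one_left, ← gaugeAct_mul, mul_inv_cancel, gaugeAct_one]
  have hT : c.lamST c.k = c.lamS := funext fun j => lamST_top_apply c j
  have h129' : Restr129Z L c.k (c.lamST c.k) (1 : Site d → Fin d → 𝔸ˣ) u := by rw [hT]; exact h129
  have hone : ∀ x κ, (1 : Site d → Fin d → 𝔸ˣ) x κ ∈ unitaryUnits 𝔸 := fun _ _ => (unitaryUnits 𝔸).one_mem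
  exact H42_of_inAx_γ hd2 hη hLs hs c.k hone hα₀' hα₁' hα₂ hα3' hα4' hsm hc₃ hsmall₁ c.sq
    (hΩ_sq c hL) c.lamST c.lamBPT (lamBPT_hbox_pred c hLs) (lamBPT_hclass c hLs)
    h33 h34 hAx h135 (fun _ _ => True) c.k hk le_rfl u (gaugeAct u⁻¹ U'') _ hu hgU h129' trivial hsa hWA hzero

end KLevel

/-! ## §2 Margins and the level-`0` cell of the record cube family, CENTRED (bookkeeping for the crown's norm step) -/

section Margins

/-- (RECORD TWIN of `B9SupplySockB9P3ZdLettersOmega.margin2_cubeFam`.) **THE RECORD CUBE FAMILY `{□_j}_{j=0}^{k}` OF (1.131)∕(1.132) HAS `Margin2`** when `R₁M₁ ≥ 2`: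
the margins of p. 98 satisfy `m₀ = m₁ + R₁M₁` and `m_j ≤ m₁` for `1 ≤ j ≤ k` (the engine's `margin_succ`∕`margin_anti` verbatim; CENTRED boxes `B8Eq131CubesRec.cube_eq`), so
the ℓ∞-`2`-neighbourhood of `□_j` lies in `□₀`. [cite: Balaban1985RegularSpaces, p.98 («a distance between boundaries of these cubes is equal to R₁M₁Lʲη»), (1.131)–(1.132) p.99; Balaban1987RG1, (0.3) p.252] -/
theorem margin2_cubeFamZ {L : ℕ} (hL : Odd L) (a : Site d) (M : ℕ) {ρ : ℕ} (hρ : 2 ≤ ρ) (k : ℕ) : Margin2 (cubeFamZ false L a M ρ k) := by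
  intro j hj v hv y hy
  by_cases hjk : j ≤ k
  · rw [cubeFam_false_of_le L a M ρ hjk, cube_eq hL hjk] at hv
    rw [cubeFam_false_zero, cube_eq hL (Nat.zero_le k)]
    have hk : 0 < k := by omega
    -- m₀ = m₁ + ρ and m_j ≤ m₁
    have h01 : L ^ 0 * (ρ * gs L (k - 0)) = L ^ (0 + 1) * (ρ * gs L (k - (0 + 1))) + ρ * L ^ 0 := margin_succ hk
    have hj1 : L ^ j * (ρ * gs L (k - j)) ≤ L ^ 1 * (ρ * gs L (k - 1)) := margin_anti L ρ k 1 j hj hjk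
    have hm : (L ^ j * (ρ * gs L (k - j)) : ℤ) + 2 ≤ (L ^ 0 * (ρ * gs L (k - 0)) : ℕ) := by
      rw [h01]
      simp only [zero_add, pow_zero, mul_one] at hj1 ⊢
      push_cast
      have := (Nat.cast_le (α := ℤ)).mpr hj1
      push_cast at this
      have hρ' : (2 : ℤ) ≤ ρ := by exact_mod_cast hρ
      linarith
    intro i
    obtain ⟨h1, h2⟩ := hv i
    obtain ⟨h3, h4⟩ := hy i
    simp only [bLoZ, bHiZ] at h1 h2 ⊢
    push_cast at h1 h2 hm ⊢
    constructor <;> linarith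
  · rw [cubeFam_of_lt false L a M ρ (by omega)] at hv
    exact absurd hv (Set.notMem_empty v)

variable {L K : ℕ} {Ω : ℕ → Set (Site d)} (c : CubeB8DZ d L K Ω)

/-- **BELOW THE TOP THE PURE RECORD CELL LIES IN THE DENTED RECORD CELL** (`j < k`; twin of `B8DentedCubeMemberLamBPrime.cubeLam_subset_lamS`): equal for `j + 1 < k`, and at
`j = k − 1` the dented cell is [6]'s ENLARGED by the dent's labels. [cite: Balaban1985Variational, (148)–(150) p.301; Balaban1985RegularSpaces, (1.5) p.77, (1.131) p.99; Balaban1987RG1, (0.3) p.252] -/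
theorem cubeLamZ_subset_lamS {j : ℕ} (hj : j < c.k) : cubeLamZ L c.a c.M c.ρ c.k j ⊆ c.lamS j := by
  intro z hz
  obtain ⟨hsq, hnin⟩ := hz
  have hle : j ≤ c.k := hj.le
  have hne : j ≠ c.k := Nat.ne_of_lt hj
  simp only [CubeB8DZ.lamS, if_pos hle, Set.mem_setOf_eq]
  exact ⟨hsq, fun h => absurd h hne, fun _ h => hnin hj h.1⟩

/-- **A FINE SITE OF `Ω′₀ = □₀` OUTSIDE `□₁` IS A LEVEL-`0` DENTED RECORD CELL LABEL** (`k ≥ 1`, odd `L`): `□₀ = □₀^{(0)}` (depth `0`), `□₁ = B(□₁^{(1)})` is the inner box of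
`Λ′₀` (`B8Eq131CubesRec.inner_eq_blowup`), so the site lies in `Λ₀ = □₀^{(0)} ∖ □₁^{(0)} ⊆ Λ′₀`. [cite: Balaban1985RegularSpaces, (1.5) p.77, (1.131) p.99; Balaban1985Variational, (148)–(150) p.301; Balaban1987RG1, (0.3) p.252] -/
theorem mem_lamS_zero_of_not_mem_cube_one (hL : Odd L) {y : Site d} (hy : y ∈ c.sq 0) (hy1 : y ∉ cubeFamZ false L c.a c.M c.ρ c.k 1) : y ∈ c.lamS 0 := by
  have hk : 1 ≤ c.k := c.one_le_k
  rw [c.sq_zero] at hy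
  rw [cubeFam_false_of_le L c.a c.M c.ρ hk] at hy1
  refine cubeLamZ_subset_lamS c hk ⟨?_, fun _ hin => hy1 ?_⟩
  · intro i
    have h := hy i
    simp only [B8Ineq130Rec.tlo_zero, B8Ineq130Rec.thi_zero] at h
    exact h
  · obtain ⟨hlo, hhi⟩ := inner_eq_blowup hL c.a c.M c.ρ hk
    show InBox (tlo L (sqLoZ L c.a c.ρ c.k 1) 1) (thi L (sqHiZ L c.a c.M c.ρ c.k 1) 1) y
    rw [← hlo, ← hhi]
    exact hin

end Margins

end Literature.MathematicalPhysics.QuantumFieldTheory.Balaban1983to89.B8Prop6DentedCubeMemberNormsGammaRec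

end
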